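import Summits.AtomisticToContinuum.Crystallization.Theorems.FreeSplittingCertificatesApproxFiniteRangeSplitting

/-!
# FreeSplittingCertificates · ApproxFiniteRangeSplitting — part B (§4–§7)

Part of the split landing of lens-1 g38 v3 `FreeSplittingCertificatesApproxFiniteRangeSplitting.lean` (sha256 6ca014fa…, 1642 l; module docstring of
record in part 1 `…ApproxFiniteRangeSplitting` / the lens file).  Declarations byte-identical; split for the 400-line rule by prover hand 1, gen 12
(decomp-a2c), --supports stmt-AtomisticToContinuum-12562 (the last part `…Holds` closes it).
-/

namespace Summit.AtomisticToContinuum.Crystallization.Theorems.FreeSplittingCertificatesApproxFiniteRangeSplitting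

open scoped BigOperators
open Literature.MathematicalPhysics.StatisticalMechanics
open Summit.AtomisticToContinuum.Crystallization.Theses.FreeSplittingCertificates

noncomputable section

/-! ## §4 The exponent-5 shell sum and the DEFICIT TAIL BOUND (P3, PROVED — the lens-1
technique transfer: packing count per shell + `∑ b⁻² ≤ 2`, as in the tree lemma
`sum_inv_pow_six_le` with the exponent lowered to 5) -/

/-- **Shell sum, exponent 5.** If all mutual distances in `x` are `≥ r > 0`, then
`∑_{k ≠ i} |xᵢ - x_k|⁻⁵ ≤ 250 · r⁻⁵` (shell `b` holds `≤ (2b+3)³ ≤ 125 b³` particles, each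
`≤ (b r)⁻⁵`, and `∑_{b ≥ 1} b⁻² ≤ 2`). [folklore; twin of `sum_inv_pow_six_le`] -/
theorem sum_inv_pow_five_le {N : ℕ} (x : Fin N → EuclideanSpace ℝ (Fin 3)) {r : ℝ} (hr : 0 < r)
    (hsep : ∀ k l, k ≠ l → r ≤ dist (x k) (x l)) (i : Fin N) :
    ∑ k ∈ Finset.univ.erase i, (dist (x i) (x k))⁻¹ ^ 5 ≤ 250 * r⁻¹ ^ 5 := by
  classical
  set s := Finset.univ.erase i with hs_def
  set m : Fin N → ℕ := fun k => ⌊dist (x i) (x k) / r⌋₊ with hm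
  set t := s.image m with ht_def
  have hmem : ∀ k ∈ s, m k ∈ t := fun k hk => Finset.mem_image_of_mem m hk
  have hks : ∀ k ∈ s, r ≤ dist (x i) (x k) := fun k hk =>
    hsep i k (Finset.ne_of_mem_erase hk).symm
  have hm1 : ∀ k ∈ s, 1 ≤ m k := fun k hk =>
    (Nat.one_le_floor_iff _).2 ((one_le_div hr).2 (hks k hk))
  have hmle : ∀ k ∈ s, r * m k ≤ dist (x i) (x k) := fun k hk => by
    have := Nat.floor_le (div_nonneg dist_nonneg hr.le : 0 ≤ dist (x i) (x k) / r)
    rwa [le_div_iff₀ hr, mul_comm] at this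
  have hmlt : ∀ k ∈ s, dist (x i) (x k) < (m k + 1) * r := fun k hk => by
    have := Nat.lt_floor_add_one (dist (x i) (x k) / r)
    rwa [div_lt_iff₀ hr] at this
  have step1 : ∑ k ∈ s, (dist (x i) (x k))⁻¹ ^ 5 ≤ ∑ k ∈ s, r⁻¹ ^ 5 * ((m k : ℝ))⁻¹ ^ 5 := by
    refine Finset.sum_le_sum fun k hk => ?_
    rw [← mul_pow, ← mul_inv]
    have h0 : 0 < r * m k := mul_pos hr (by exact_mod_cast hm1 k hk)
    exact pow_le_pow_left₀ (inv_nonneg.2 dist_nonneg) (inv_anti₀ h0 (hmle k hk)) _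
  have step2 : ∑ k ∈ s, r⁻¹ ^ 5 * ((m k : ℝ))⁻¹ ^ 5 =
      ∑ b ∈ t, ((s.filter fun k => m k = b).card : ℝ) * (r⁻¹ ^ 5 * ((b : ℝ))⁻¹ ^ 5) := by
    have := Finset.sum_fiberwise_of_maps_to' hmem (fun b : ℕ => r⁻¹ ^ 5 * ((b : ℝ))⁻¹ ^ 5)
    simp only [Finset.sum_const, nsmul_eq_mul] at this
    exact this.symm
  have step3 : ∀ b ∈ t, ((s.filter fun k => m k = b).card : ℝ) ≤ (2 * (b : ℝ) + 3) ^ 3 := by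
    intro b hb
    set F := s.filter fun k => m k = b with hF
    have hinj : Set.InjOn x F := fun k _ l _ hkl => by
      by_contra hne
      have := hsep k l hne
      rw [hkl, dist_self] at this
      exact absurd this (not_le.2 hr)
    rw [← Finset.card_image_of_injOn hinj]
    have hR : (0 : ℝ) ≤ ((b : ℝ) + 1) * r := by positivity
    have := card_le_of_separated_of_dist_le (F.image x) (x i) hr hR ?_ ?_
    · rw [finrank_euclideanSpace_fin] at this
      convert this using 2
      field_simp
      ring
    · intro c hc
      obtain ⟨k, hk, rfl⟩ := Finset.mem_image.1 hc
      obtain ⟨hks', hkb⟩ := Finset.mem_filter.1 hk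
      rw [dist_comm]
      have := hmlt k hks'
      rw [hkb] at this
      exact this.le
    · intro c hc c' hc' hne
      obtain ⟨k, -, rfl⟩ := Finset.mem_image.1 hc
      obtain ⟨l, -, rfl⟩ := Finset.mem_image.1 hc'
      exact hsep k l fun h => hne (h ▸ rfl)
  have step4 : ∀ b ∈ t, (2 * (b : ℝ) + 3) ^ 3 * (r⁻¹ ^ 5 * ((b : ℝ))⁻¹ ^ 5) ≤
      125 * r⁻¹ ^ 5 * ((b : ℝ) ^ 2)⁻¹ := by
    intro b hb
    obtain ⟨k, hk, rfl⟩ := Finset.mem_image.1 hb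
    have hb1 : (1 : ℝ) ≤ (m k : ℝ) := by exact_mod_cast hm1 k hk
    set β : ℝ := (m k : ℝ)
    have hβ : 0 < β := by linarith
    have hr5 : 0 < r⁻¹ ^ 5 := by positivity
    have key : (2 * β + 3) ^ 3 * (β⁻¹) ^ 5 ≤ 125 * (β ^ 2)⁻¹ := by
      rw [inv_pow, ← div_eq_mul_inv, ← div_eq_mul_inv,
        div_le_div_iff₀ (by positivity) (by positivity)]
      have h5 : (2 * β + 3) ^ 3 ≤ (5 * β) ^ 3 :=
        pow_le_pow_left₀ (by positivity) (by linarith) 3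
      nlinarith [mul_le_mul_of_nonneg_right h5 (sq_nonneg β)]
    calc (2 * β + 3) ^ 3 * (r⁻¹ ^ 5 * (β⁻¹) ^ 5) = r⁻¹ ^ 5 * ((2 * β + 3) ^ 3 * (β⁻¹) ^ 5) := by
          ring
      _ ≤ r⁻¹ ^ 5 * (125 * (β ^ 2)⁻¹) := mul_le_mul_of_nonneg_left key hr5.le
      _ = 125 * r⁻¹ ^ 5 * (β ^ 2)⁻¹ := by ring
  have step5 : ∑ b ∈ t, ((b : ℝ) ^ 2)⁻¹ ≤ 2 := by
    have hsub : t ⊆ Finset.Ioo 0 (t.sup id + 1) := fun b hb => by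
      rw [Finset.mem_Ioo]
      obtain ⟨k, hk, rfl⟩ := Finset.mem_image.1 hb
      exact ⟨hm1 k hk, Nat.lt_succ_of_le (Finset.le_sup (f := id) hb)⟩
    have h2 := sum_Ioo_inv_sq_le (α := ℝ) 0 (t.sup id + 1)
    calc ∑ b ∈ t, ((b : ℝ) ^ 2)⁻¹ ≤ ∑ b ∈ Finset.Ioo 0 (t.sup id + 1), ((b : ℝ) ^ 2)⁻¹ :=
          Finset.sum_le_sum_of_subset_of_nonneg hsub fun b _ _ => by positivity
      _ ≤ 2 := by simpa using h2
  have hr5 : 0 ≤ r⁻¹ ^ 5 := by positivity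
  calc ∑ k ∈ s, (dist (x i) (x k))⁻¹ ^ 5
      ≤ ∑ b ∈ t, ((s.filter fun k => m k = b).card : ℝ) * (r⁻¹ ^ 5 * ((b : ℝ))⁻¹ ^ 5) :=
        step1.trans_eq step2
    _ ≤ ∑ b ∈ t, (2 * (b : ℝ) + 3) ^ 3 * (r⁻¹ ^ 5 * ((b : ℝ))⁻¹ ^ 5) :=
        Finset.sum_le_sum fun b hb => mul_le_mul_of_nonneg_right (step3 b hb) (by positivity)
    _ ≤ ∑ b ∈ t, 125 * r⁻¹ ^ 5 * ((b : ℝ) ^ 2)⁻¹ := Finset.sum_le_sum step4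
    _ = 125 * r⁻¹ ^ 5 * ∑ b ∈ t, ((b : ℝ) ^ 2)⁻¹ := by rw [Finset.mul_sum]
    _ ≤ 125 * r⁻¹ ^ 5 * 2 := mul_le_mul_of_nonneg_left step5 (by positivity)
    _ = 250 * r⁻¹ ^ 5 := by ring

/-- The negative part of the Lennard-Jones potential is at most its attractive branch:
`max 0 (-V_LJ(r)) ≤ (1/6) r⁻⁶`. -/
theorem negPart_lennardJones_le (r : ℝ) :
    max 0 (-lennardJones r) ≤ (1 / 6) * r⁻¹ ^ 6 := by
  unfold lennardJones
  have h0 : 0 ≤ (r⁻¹) ^ 12 := by positivity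
  have h1 : 0 ≤ (r⁻¹) ^ 6 := by positivity
  refine max_le (by positivity) ?_
  nlinarith

/-- The boundary-crossing factor of one bond in the block average, `min 1 (√3 r / L)`, times the
bond's attractive part: termwise bound `≤ (√3/(6L)) r⁻⁵` for `r > 0`. -/
theorem deficit_term_le {r L : ℝ} (hr : 0 < r) (hL : 0 < L) :
    max 0 (-lennardJones r) * min 1 (Real.sqrt 3 * r / L) ≤
      Real.sqrt 3 / (6 * L) * r⁻¹ ^ 5 := by
  have h3 : 0 ≤ Real.sqrt 3 := Real.sqrt_nonneg 3
  have hmin : min 1 (Real.sqrt 3 * r / L) ≤ Real.sqrt 3 * r / L := min_le_right _ _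
  have hmin0 : 0 ≤ min 1 (Real.sqrt 3 * r / L) := le_min zero_le_one (by positivity)
  have hneg := negPart_lennardJones_le r
  have hneg0 : 0 ≤ max 0 (-lennardJones r) := le_max_left _ _
  calc max 0 (-lennardJones r) * min 1 (Real.sqrt 3 * r / L)
      ≤ (1 / 6) * r⁻¹ ^ 6 * (Real.sqrt 3 * r / L) :=
        mul_le_mul hneg hmin hmin0 (by positivity)
    _ = Real.sqrt 3 / (6 * L) * r⁻¹ ^ 5 := by
        field_simp
        try ring

/-- **P3 · DeficitTailBound (PROVED).** On a `δ`-separated configuration the total boundary loss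
of the block-averaged rule at block side `L` is `≤ (125√3/6)·δ⁻⁵/L` at every site:
`½ ∑_{j≠i} V⁻(r_ij)·min(1, √3 r_ij/L) ≤ (√3/(12L)) ∑_{j≠i} r_ij⁻⁵ ≤ (√3/(12L))·250 δ⁻⁵`. -/
theorem deficit_tail_bound {N : ℕ} {δ L : ℝ} (hδ : 0 < δ) (hL : 0 < L)
    (x : Fin N → EuclideanSpace ℝ (Fin 3)) (hx : Separated δ x) (i : Fin N) :
    (1 / 2) * ∑ j ∈ Finset.univ.erase i,
        max 0 (-lennardJones (dist (x i) (x j))) * min 1 (Real.sqrt 3 * dist (x i) (x j) / L)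
      ≤ (125 * Real.sqrt 3 / 6) * δ⁻¹ ^ 5 / L := by
  have hsep : ∀ k l, k ≠ l → δ ≤ dist (x k) (x l) := hx
  have hsum := sum_inv_pow_five_le x hδ hsep i
  have hterm : ∀ j ∈ Finset.univ.erase i,
      max 0 (-lennardJones (dist (x i) (x j))) * min 1 (Real.sqrt 3 * dist (x i) (x j) / L) ≤
        Real.sqrt 3 / (6 * L) * (dist (x i) (x j))⁻¹ ^ 5 := by
    intro j hj
    have hne : i ≠ j := (Finset.ne_of_mem_erase hj).symm
    have hr : 0 < dist (x i) (x j) := lt_of_lt_of_le hδ (hx i j hne)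
    exact deficit_term_le hr hL
  have h3 : 0 ≤ Real.sqrt 3 := Real.sqrt_nonneg 3
  have hc : 0 ≤ Real.sqrt 3 / (6 * L) := by positivity
  calc (1 / 2) * ∑ j ∈ Finset.univ.erase i,
        max 0 (-lennardJones (dist (x i) (x j))) * min 1 (Real.sqrt 3 * dist (x i) (x j) / L)
      ≤ (1 / 2) * ∑ j ∈ Finset.univ.erase i, Real.sqrt 3 / (6 * L) * (dist (x i) (x j))⁻¹ ^ 5 := by
        have := Finset.sum_le_sum hterm
        linarith
    _ = (1 / 2) * (Real.sqrt 3 / (6 * L)) * ∑ j ∈ Finset.univ.erase i, (dist (x i) (x j))⁻¹ ^ 5 := by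
        rw [Finset.mul_sum, Finset.mul_sum]
        refine Finset.sum_congr rfl fun j _ => by ring
    _ ≤ (1 / 2) * (Real.sqrt 3 / (6 * L)) * (250 * δ⁻¹ ^ 5) :=
        mul_le_mul_of_nonneg_left hsum (by positivity)
    _ = (125 * Real.sqrt 3 / 6) * δ⁻¹ ^ 5 / L := by
        field_simp
        try ring

/-! ## §5 P2 · the BLOCK-AVERAGING LEMMA (the ONE leaf of the k = 1 rung; KNOWN-type,
potential-agnostic bookkeeping, NOT YET IN THE TREE)

Statement: for ANY pair potential `V`, floor `f` and block side `L > 0` — if every finite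
injective configuration admits a boxed complementary splitting of its own bonds with `V`-floor
`f` (for `V = V_LJ`, `f = e_∞` this is EXACTLY the tree-proved route item `FreePairSplitting`,
12563), then there is a boxed complementary RULE of radius `√3·L` whose weighted site energies
are `≥ f − ½ ∑_{j≠i} V⁻(r_ij)·min(1, √3 r_ij/L)` on every finite injective configuration.

Paper proof (complete; = the refuter evidence PROOF-SKETCH.md on 12562, 2026-08-15, made
potential-agnostic): (1) for a finite set `S ⊂ ℝ³` choose translation-EQUIVARIANTLY a splitting
`W_S` of the bonds of `S` with floor `f` (hypothesis, via a lexicographic anchor of `S`);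
(2) define `Φ(v,T) := L⁻³ ∫_{c ∈ (-L,0]³} g(c) dc`, `g(c) := W_{T ∩ Q_c}(0 → v)` if
`v ∈ Q_c := c + [0,L)³` (the cubes `Q_c ∋ 0`), else `½` — a finite-range step function of `c`,
so the integral is a finite sum; (3) box: an average of `[0,1]`-values; complementarity: the
change of variables `c ↦ c − v` maps `{c : 0, v ∈ Q_c}` onto `{c' : 0, -v ∈ Q_{c'}}` in the
partner's frame, where the two equivariant weights sum to `1`, and the two complements (value `½`
each) have equal volume; (4) in a configuration, `Q_c ∋ 0` has diameter `√3 L`, so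
`T_{ij} ∩ Q_c = (x − x_i) ∩ Q_c` is the SAME sub-configuration for every partner `j`; (5) Fubini
for the finite sum over `j`: for each `c` the bonds inside `Q_c` carry `W`'s floor `≥ f`, the
bonds leaving `Q_c` carry `½ V ≥ -½ V⁻`; (6) the fraction of cubes `Q_c ∋ 0` missing `v` is
`1 − ∏_k (1 − |v_k|/L)₊ ≤ min(1, ∑_k |v_k|/L) ≤ min(1, √3‖v‖/L)`.
Lean size: M–L (Bochner integral of a finite-range step function over a box, translation change
of variables, the product-volume bound, an equivariant choice). Why it might fail: it cannot —
it is a theorem of bookkeeping; the only risk is a typing slip in this statement (probes §8). -/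

/-- **P2 · BlockAveragedRule** (leaf; KNOWN-type · ATTACKABLE·M–L · potential-agnostic). -/
def BlockAveragedRule : Prop :=
  ∀ (V : ℝ → ℝ) (f L : ℝ), 0 < L →
    (∀ (n : ℕ) (y : Fin n → EuclideanSpace ℝ (Fin 3)), Function.Injective y →
        ∃ w : Fin n → Fin n → ℝ, (∀ a b, a ≠ b → 0 ≤ w a b ∧ w a b + w b a = 1) ∧
          ∀ a, f ≤ ∑ b ∈ Finset.univ.erase a, w a b * V (dist (y a) (y b))) →
    ∃ Φ : EuclideanSpace ℝ (Fin 3) → Finset (EuclideanSpace ℝ (Fin 3)) → ℝ, RuleBox Φ ∧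
      ∀ (N : ℕ) (x : Fin N → EuclideanSpace ℝ (Fin 3)), Function.Injective x → ∀ i : Fin N,
        f - (1 / 2) * ∑ j ∈ Finset.univ.erase i,
            max 0 (-V (dist (x i) (x j))) * min 1 (Real.sqrt 3 * dist (x i) (x j) / L)
          ≤ ∑ j ∈ Finset.univ.erase i,
              Φ (x j - x i) ((Finset.univ.filter fun l =>
                  dist (x l) (x i) ≤ Real.sqrt 3 * L ∨ dist (x l) (x j) ≤ Real.sqrt 3 * L).image
                fun l => x l - x i) * V (dist (x i) (x j))

/-! ## §6 KERNEL (PROVED, 0 sorry): P2 ∧ P1(tree) ∧ P3 ⟹ the k = 1 rung ⟹ r5 BY NAME -/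

/-- P1 is the tree-proved route item 12563, in exactly the shape P2 consumes
(`V = V_LJ`, `f = e_∞`). -/
theorem blockCertificates_lennardJones :
    ∀ (n : ℕ) (y : Fin n → EuclideanSpace ℝ (Fin 3)), Function.Injective y →
      ∃ w : Fin n → Fin n → ℝ, (∀ a b, a ≠ b → 0 ≤ w a b ∧ w a b + w b a = 1) ∧
        ∀ a, eInf ≤ ∑ b ∈ Finset.univ.erase a, w a b * lennardJones (dist (y a) (y b)) :=
  Summit.AtomisticToContinuum.Crystallization.Theorems.freePairSplitting_proof

/-- The block-averaged rule at block side `L` has floor `e_∞ − (125√3/6)·δ⁻⁵/L` at radius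
`√3·L` on `δ`-separated configurations. -/
theorem ruleFloor_of_blockAveraging (hP2 : BlockAveragedRule) {δ L : ℝ} (hδ : 0 < δ)
    (hL : 0 < L) :
    RuleFloor δ (Real.sqrt 3 * L) (eInf - (125 * Real.sqrt 3 / 6) * δ⁻¹ ^ 5 / L) := by
  obtain ⟨Φ, hbox, hfloor⟩ := hP2 lennardJones eInf L hL blockCertificates_lennardJones
  refine ⟨Φ, hbox, fun N x hx i => ?_⟩
  have hinj : Function.Injective x := injective_of_separated hδ hx
  have h1 := hfloor N x hinj i
  have h2 := deficit_tail_bound hδ hL x hx i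
  unfold weightedSiteEnergy bondPattern
  linarith

/-- **THE k = 1 RUNG from P2** (with P1 from the tree and P3 proved here):
`C(δ) = (125/2)·δ⁻⁵`, block side `L = R/√3`. -/
theorem rateRung_one_of_blockAveraging (hP2 : BlockAveragedRule) : RateRung 1 := by
  intro δ hδ
  refine ⟨(125 / 2) * δ⁻¹ ^ 5, by positivity, fun R hR => ?_⟩
  have hRpos : 0 < R := by linarith
  have h3pos : 0 < Real.sqrt 3 := Real.sqrt_pos.2 (by norm_num)
  have hL : 0 < R / Real.sqrt 3 := div_pos hRpos h3pos
  have h := ruleFloor_of_blockAveraging hP2 hδ hL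
  have hrad : Real.sqrt 3 * (R / Real.sqrt 3) = R := by field_simp
  have hsq : Real.sqrt 3 * Real.sqrt 3 = 3 := Real.mul_self_sqrt (by norm_num)
  have hfloor : eInf - (125 * Real.sqrt 3 / 6) * δ⁻¹ ^ 5 / (R / Real.sqrt 3) =
      eInf - (125 / 2) * δ⁻¹ ^ 5 / R ^ 1 := by
    rw [pow_one]
    field_simp
    nlinarith [hsq]
  rw [hrad, hfloor] at h
  exact h

/-- **r5 = 12562 `ApproxFiniteRangeSplitting` from P2 alone, BY NAME** (the kernel of the node:
hypotheses = the one leaf P2; P1 = tree theorem, P3 = §4). Explicitly `R(δ,ε) = (125/2)·δ⁻⁵/ε + 1`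
suffices. -/
theorem approxFiniteRangeSplitting_of_blockAveraging (hP2 : BlockAveragedRule) :
    ApproxFiniteRangeSplitting :=
  approxFiniteRangeSplitting_of_rateRung le_rfl (rateRung_one_of_blockAveraging hP2)

/-- And the route's bottom `Ladder` clause closes outright under P2 (sanity: the composite
`FiniteRangeSplitting → ApproxFiniteRangeSplitting` needs no hypothesis at all, §3). -/
theorem ladder_bottom_of_blockAveraging (hP2 : BlockAveragedRule) :
    FiniteRangeSplitting → ApproxFiniteRangeSplitting :=
  fun _ => approxFiniteRangeSplitting_of_blockAveraging hP2


/-! ## §7 Cruxes / tags block (cell grammar, for the writer's TREE.md) — v2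

* TARGET  `FreeSplittingCertificates.ApproxFiniteRangeSplitting` (stmt-12562, r5) — **PROVED (v2, §10
  `approxFiniteRangeSplitting_holds`, 0 sorry, axioms standard)** ⟸ `RateRung 1` (PROVED, `rateRung_one_holds`)
  ⟸ P2 (PROVED, §9). OFF closes-path (row 406); closes the ledger item once landed by hands.
* P1 `FreePairSplitting` (stmt-12563) — TREE · PROVED.
* P2 `BlockAveragedRule` — **PROVED (v2, §9 `P2.blockAveragedRule_holds`)** · potential-agnostic (no LJ content).
* P3 `deficit_tail_bound` (+ `sum_inv_pow_five_le`) — PROVED here.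
* `RateRung k`, k ≥ 2 — UNDECIDED · IDEA-NEEDED (beat block averaging; far-field response).
* `FiniteRangeSplitting` (stmt-12559, r2; "k = ∞") — UNDECIDED · BARRIER-adjacent (ultimate frustration);
  ⟹ ∀ k RateRung k (PROVED).
* `StrictSplittingRule` (stmt-12560, r3, ON-PATH) — untouched; ⟹ ∀ k RateRung k (PROVED, §8 PASS).
* METHOD CEILING of block-LP + Haar averaging: k = 1 exactly.
-/

end

end Summit.AtomisticToContinuum.Crystallization.Theorems.FreeSplittingCertificatesApproxFiniteRangeSplitting
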